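import Summits.Ventures.PercRepro.RankLevelSet
import Summits.Ventures.PercRepro.RankLevelSetHClose

/-!
# PercRepro — C-025 Theorem H: `(p, q) = (4, 2)` on every simple matroid, in the spelling of `C025` (p2, gen 5)

`RankLevelSetHCore.lean` proves `4·#U(4,2) ≤ 3·#{S : ρ(S) = 3}` on finsets (mine-2, `MINE2-RLS.md` §8, with the
crude per-line bounds).  Here it is restated with the set-builders of `C025` (`A ⊆ M.E`, `M.eRk`, `Set.ncard`,
`phiK 4 2 = 4/3`): **`c025_four_two_of_simple`** — for every finite matroid in which any two distinct points of the
ground set have rank `2` (no loops, no parallel pairs),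
`phiK 4 2 · #{A ⊆ E : ρ(A) = 4, ρ(E ∖ A) = 2} ≤ #{A ⊆ E : 2 < ρ(A) < 4}`.
The reduction from an arbitrary matroid to a simple one (loops halve both sides; a parallel pair is Theorem F's
two-sum identity, `MINE2-RLS.md` §15.1) is not part of this file.
-/

namespace PercRepro

open Finset

namespace ThmH

variable {α : Type*} [DecidableEq α] {M : Matroid α} [M.Finite]

omit [DecidableEq α] in
/-- `Set.ncard` of a family `{S ⊆ E | P S}` of subsets of the finite ground set as a `Finset.card` over `gr M`. -/
theorem ncard_family_eq_card (M : Matroid α) [M.Finite] (P : Set α → Prop) [DecidablePred P] :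
    {S : Set α | S ⊆ M.E ∧ P S}.ncard = ((gr M).powerset.filter (fun B : Finset α => P (B : Set α))).card := by
  have himg : {S : Set α | S ⊆ M.E ∧ P S} =
      (fun B : Finset α => (B : Set α)) ''
        (((gr M).powerset.filter (fun B : Finset α => P (B : Set α)) : Finset (Finset α)) : Set (Finset α)) := by
    ext S
    constructor
    · rintro ⟨hS, hP⟩
      have hSf : S.Finite := M.ground_finite.subset hS
      refine ⟨hSf.toFinset, ?_, hSf.coe_toFinset⟩
      rw [Finset.mem_coe, Finset.mem_filter, Finset.mem_powerset, hSf.coe_toFinset]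
      refine ⟨?_, hP⟩
      rw [← Finset.coe_subset, hSf.coe_toFinset, coe_gr]
      exact hS
    · rintro ⟨B, hB, rfl⟩
      rw [Finset.mem_coe, Finset.mem_filter, Finset.mem_powerset] at hB
      refine ⟨?_, hB.2⟩
      rw [← coe_gr M]
      exact Finset.coe_subset.2 hB.1
  rw [himg, Set.ncard_image_of_injective _ Finset.coe_injective, Set.ncard_coe_finset]

/-- The `U(4,2)` set-builder of `C025` counts `Uf M`. -/
theorem ncard_U_eq (M : Matroid α) [M.Finite] :
    {A : Set α | A ⊆ M.E ∧ M.eRk A = ((4 : ℕ) : ℕ∞) ∧ M.eRk (M.E \ A) = ((2 : ℕ) : ℕ∞)}.ncard = (Uf M).card := by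
  rw [ncard_family_eq_card M (fun A => M.eRk A = ((4 : ℕ) : ℕ∞) ∧ M.eRk (M.E \ A) = ((2 : ℕ) : ℕ∞))]
  unfold Uf
  congr 1
  apply Finset.filter_congr
  intro B _
  rw [Finset.coe_sdiff, coe_gr]
  push_cast
  exact Iff.rfl

omit [DecidableEq α] in
/-- The `Y(4,2)` set-builder of `C025` counts `Yall M` (the rank of a finite set is a natural number). -/
theorem ncard_Y_eq (M : Matroid α) [M.Finite] :
    {A : Set α | A ⊆ M.E ∧ ((2 : ℕ) : ℕ∞) < M.eRk A ∧ M.eRk A < ((4 : ℕ) : ℕ∞)}.ncard = (Yall M).card := by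
  rw [ncard_family_eq_card M (fun A => ((2 : ℕ) : ℕ∞) < M.eRk A ∧ M.eRk A < ((4 : ℕ) : ℕ∞))]
  unfold Yall
  congr 1
  apply Finset.filter_congr
  intro B _
  obtain ⟨u, hu⟩ : ∃ u : ℕ, M.eRk (B : Set α) = u := by
    have : M.eRk (B : Set α) ≠ ⊤ := by
      refine ne_top_of_le_ne_top ?_ (M.eRk_le_encard _)
      rw [Set.encard_coe_eq_coe_finsetCard]; exact ENat.coe_ne_top _
    exact ENat.ne_top_iff_exists.1 this |>.imp fun u hu => hu.symm
  rw [hu]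
  constructor
  · rintro ⟨h1, h2⟩
    have h1' : 2 < u := by exact_mod_cast h1
    have h2' : u < 4 := by exact_mod_cast h2
    have : u = 3 := by omega
    rw [this]; rfl
  · intro h
    have h' : u = 3 := by exact_mod_cast h
    subst h'
    exact ⟨by norm_num, by norm_num⟩

/-- `Φ(4, 2) = 4/3`. -/
theorem phiK_four_two : phiK 4 2 = 4 / 3 := by
  unfold phiK
  rw [show Finset.Ioo 2 4 = {3} from by decide, Finset.sum_singleton,
    show Nat.choose 6 3 = 20 by decide, show Nat.choose 6 4 = 15 by decide]
  norm_num

end ThmH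

open ThmH in
/-- **C-025 at `(p, q) = (4, 2)` on every simple matroid** (mine-2 Theorem H, `MINE2-RLS.md` §8): for every finite
matroid `M` in which any two distinct points of the ground set have rank `2`,
`phiK 4 2 · #{A ⊆ E : ρ(A) = 4, ρ(E ∖ A) = 2} ≤ #{A ⊆ E : 2 < ρ(A) < 4}` — the body of `C025` at `p = 4`, `q = 2`. -/
theorem c025_four_two_of_simple {α : Type*} (M : Matroid α) [M.Finite]
    (hs : ∀ e ∈ M.E, ∀ f ∈ M.E, e ≠ f → M.eRk {e, f} = 2) :
    phiK 4 2 * ({A : Set α | A ⊆ M.E ∧ M.eRk A = ((4 : ℕ) : ℕ∞) ∧ M.eRk (M.E \ A) = ((2 : ℕ) : ℕ∞)}.ncard : ℚ) ≤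
      ({A : Set α | A ⊆ M.E ∧ ((2 : ℕ) : ℕ∞) < M.eRk A ∧ M.eRk A < ((4 : ℕ) : ℕ∞)}.ncard : ℚ) := by
  classical
  rw [ncard_U_eq, ncard_Y_eq, phiK_four_two]
  have h := four_mul_card_Uf_le (M := M) hs
  have h' : (4 : ℚ) * (Uf M).card ≤ 3 * (Yall M).card := by exact_mod_cast h
  linarith

end PercRepro
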